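import Summits.Schanuel.Schanuel.Theses.RootDecomp1K
import Literature.NumberTheory.Transcendental.BakerLinearFormsQuantitativeProofs
import Literature.Barriers.Schanuel.AlgebraicIndependenceOfLogarithmsProofs
import Literature.Barriers.Schanuel.NesterenkoModularScope

/-!
# RootDecomp1KB3LogBarrier — lens 6, generation 25 «THE RESIDUAL IS THE LOG BARRIER: B₃ = PolyDiophantineSchanuel (stmt-Schanuel-31987) ⊢ Literature.Barriers.Schanuel.AlgIndepLogarithms» (CLAIM L2309, PRICE + CHECKLIST G29-α L2310 (strength certificate), NODE L2324; critic VERDICT pending at staging — filed only on GO) — part 1 (RootDecomp1KB3LogBarrier01): §0 witnesses + §1 Baker 3.1 as a measure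

(lens-6 g25 HOME kernel K = HOME/decomp-schanuel-lens-6/g25/B3LogBarrier.lean e91b3d3e…, 663 l, imports Theses.RootDecomp1K + Literature BakerLinearFormsQuantitativeProofs + Barriers AlgebraicIndependenceOfLogarithmsProofs + NesterenkoModularScope; P/C + NODE-g25.md. STRENGTH CERTIFICATE, rung 0, no ∀-item moves: the route's declared RESIDUAL B₃ = `PolyDiophantineSchanuel` implies the logarithm barrier's conjecture `AlgIndepLogarithms` (Baker 1975 Thm 3.1 `baker1975_thm_3_1_holds` BY NAME, load-bearing). Port by census-1 gen 19 as `RootDecomp1KB3LogBarrier01–03`: 01 = §0 integer witnesses (`hgt`, `wit_int`, `wit_rat`) + §1 Baker's Thm 3.1 as a polynomial linear-independence measure for logarithms (`polyMeasure_of_logs`, `polyDioph_of_logs`); 02 = §2 no Liouville coordinates in the ℚ-span of logarithms of algebraic numbers (`wit_twist`, `not_liouville_of_logForm`, `not_liouville_coord_of_logs`, …); 03 = §3 `b3_hypotheses_of_logs`, `algIndepLogarithms_of_polyDiophantineSchanuel`, §4 corollaries by name (`schanuel_at_logs_…`, `algebraicIndependent_piI_log_two_…`, `transcendental_exp_pi_sq_…`,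 `threeLogarithmsConjecture_…`), §5 B₃ at z = (1, πi) (`two_le_trdeg_one_piI_…`, `expOnePiAlgebraicIndependent_of_polyDiophantineSchanuel`), §6 placement (`not_hyperLiouville_of_polyMeasure`, `logs_placement`, `cells_vacuous_at_logs`), §7 `algIndepLogarithms_of_strictDiophantineSchanuel`.
PORT EDITS: linter option dropped; twelve generic helpers private (isAlgebraic_conj/norm/cexp_re/cexp_im, not_liouville_pi, not_liouville_rat_mul_pi, two_le_one_add_sum, cast_one_add_sum, one_div_pow_ceil_le, pow_le_exp_pow_succ, abs_coeff_le_hgt, linForm_ne_zero_of_linearIndependent — dedup-safety) with per-part private copies; two docstrings added; statements and proofs verbatim. `--supports stmt-Schanuel-31987` (the residual item) unless the verdict names another; no census credit carried; rung 0 — nothing here proves Schanuel; B₃ stays OPEN.)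
-/

/-!
# Route `Schanuel/RootDecomp1K` — the residual `B₃ = PolyDiophantineSchanuel` contains the logarithm barrier

Lens-6 («barrier-complement carving»), generation 25, node 1: **every `ℚ`-free tuple of logarithms of
algebraic numbers satisfies both Diophantine hypotheses of the route's residual item
`PolyDiophantineSchanuel` (stmt-Schanuel-31987)** — no coordinate form has a Liouville real or imaginary
part, and the tuple is *not* linearly Liouville (it carries a polynomial linear-independence measure) —
by **Baker's 1975 Theorem 3.1** (the tree's PROVED fact
`Literature.NumberTheory.Transcendental.baker1975_thm_3_1_holds`, load-bearing and taken by name).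
Consequently

* `algIndepLogarithms_of_polyDiophantineSchanuel : PolyDiophantineSchanuel → AlgIndepLogarithms` — the
  residual implies the `@[conjecture]` consequent of the catalogued barrier B1
  (`Literature/Barriers/Schanuel/AlgebraicIndependenceOfLogarithms.lean`), hence (tree corollaries, by
  name) `iπ ⟂ log 2`, `e^{π²} ∉ ℚ̄`, the three-logarithms conjecture, structural rank = rank;
* `two_le_trdeg_one_piI_of_polyDiophantineSchanuel` — the residual at `z = (1, πi)` gives Schanuel's
  inequality there, whence `expOnePiAlgebraicIndependent_of_polyDiophantineSchanuel : … →
  ExpOnePiAlgebraicIndependent` (`e ⟂ π`, by the tree's `NesterenkoModularScope` transfer re-run on B₃);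
* PLACEMENT: a `ℚ`-free tuple of logarithms of algebraic numbers lies OUTSIDE the hypothesis sets of the
  route's A-cells `CoordLiouvilleSchanuel` (31077), `HyperLiouvilleSchanuel` (33363),
  `FiniteOrderLiouvilleSchanuel` (33364) and `LinLiouvilleSchanuel` (31986): the carving has put all of
  barrier B1's scope into the residual.

No `sorry`, no new axioms; Baker's theorem enters only through `baker1975_thm_3_1_holds`.
-/

noncomputable section

open Complex Polynomial IntermediateField Finset
open scoped BigOperators

namespace Summit.Schanuel.Schanuel.Theorems.RootDecomp1KB3LogBarrier

open Literature.NumberTheory.Transcendental (baker1975_thm_3_1 baker1975_thm_3_1_holds)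
open Literature.Barriers.Schanuel (AlgIndepLogarithms algebraicIndependent_of_le_trdeg_adjoin
  trdeg_adjoin_union_eq_of_isAlgebraic linearIndependent_one_piI isAlgebraic_I algebraicIndependent_real_of_complex)
open Summit.Schanuel.Schanuel.Theses.RootDecomp1K (PolyDiophantineSchanuel CoordLiouvilleSchanuel
  HyperLiouvilleSchanuel FiniteOrderLiouvilleSchanuel LinLiouvilleSchanuel StrictDiophantineSchanuel)

/-! ### §0  Integer witnesses for algebraic numbers -/

/-- The naive height `∑ |coeff|` of an integer polynomial. -/
def hgt (P : ℤ[X]) : ℕ := ∑ j ∈ P.support, (P.coeff j).natAbs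

/-- Each coefficient is bounded by the naive height `hgt`. -/
private theorem abs_coeff_le_hgt (P : ℤ[X]) (j : ℕ) : |P.coeff j| ≤ (hgt P : ℤ) := by
  unfold hgt
  push_cast
  by_cases hj : j ∈ P.support
  · exact single_le_sum (f := fun k => |P.coeff k|) (fun _ _ => abs_nonneg _) hj
  · rw [Polynomial.notMem_support_iff.mp hj, abs_zero]
    exact sum_nonneg fun _ _ => abs_nonneg _

/-- An algebraic complex number has a non-zero integer polynomial annihilator. -/
private theorem exists_intPoly_of_isAlgebraic {x : ℂ} (hx : IsAlgebraic ℚ x) :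
    ∃ P : ℤ[X], P ≠ 0 ∧ aeval x P = 0 :=
  (IsFractionRing.isAlgebraic_iff ℤ ℚ ℂ).mpr hx

/-- Common degree and height bounds for the integer witnesses of a finite family of algebraic numbers,
in the format of Baker's Theorem 3.1 (`d ≥ 2`). -/
theorem exists_common_witness {n : ℕ} (α : Fin n → ℂ) (hα : ∀ i, IsAlgebraic ℚ (α i)) :
    ∃ d A : ℕ, 2 ≤ d ∧ ∀ i, ∃ P : ℤ[X], P ≠ 0 ∧ P.natDegree ≤ d ∧
      (∀ j, |P.coeff j| ≤ (A : ℤ)) ∧ aeval (α i) P = 0 := by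
  choose P hP0 hPr using fun i => exists_intPoly_of_isAlgebraic (hα i)
  refine ⟨2 + ∑ i, (P i).natDegree, ∑ i, hgt (P i), by omega, fun i => ⟨P i, hP0 i, ?_, ?_, hPr i⟩⟩
  · have := single_le_sum (f := fun i => (P i).natDegree) (fun _ _ => Nat.zero_le _) (mem_univ i)
    omega
  · intro j
    refine (abs_coeff_le_hgt (P i) j).trans ?_
    have := single_le_sum (f := fun i => hgt (P i)) (fun _ _ => Nat.zero_le _) (mem_univ i)
    exact_mod_cast this

/-- Integer witness for an integer `U` at level `B ≥ max(2,|U|)`: `X − U` (or `X` for `U = 0`). -/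
theorem wit_int (U : ℤ) {B d : ℕ} (hB : 2 ≤ B) (hd : 2 ≤ d) (hU : U.natAbs ≤ B) :
    ∃ Q : ℤ[X], Q ≠ 0 ∧ Q.natDegree ≤ d ∧ (∀ k, |Q.coeff k| ≤ (B : ℤ)) ∧ aeval (U : ℂ) Q = 0 := by
  refine ⟨X - C U, X_sub_C_ne_zero U, ?_, ?_, by simp⟩
  · rw [natDegree_X_sub_C]; omega
  · intro k
    rw [coeff_sub, coeff_X, coeff_C]
    have hUB : |U| ≤ (B : ℤ) := by rw [← Int.natCast_natAbs]; exact_mod_cast hU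
    have hB1 : (1 : ℤ) ≤ B := by exact_mod_cast (show 1 ≤ B by omega)
    split_ifs <;> simp_all [abs_le]

/-- Integer witness for a rational `c` (`den·X − num`), height `≤ |num| + den`. -/
theorem wit_rat (c : ℚ) {B d : ℕ} (hd : 2 ≤ d) (hB : c.num.natAbs + c.den ≤ B) :
    ∃ Q : ℤ[X], Q ≠ 0 ∧ Q.natDegree ≤ d ∧ (∀ k, |Q.coeff k| ≤ (B : ℤ)) ∧ aeval (c : ℂ) Q = 0 := by
  refine ⟨C (c.den : ℤ) * X - C c.num, ?_, ?_, ?_, ?_⟩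
  · intro h
    have h1 : (C (c.den : ℤ) * X - C c.num).coeff 1 = (0 : ℤ[X]).coeff 1 := by rw [h]
    rw [coeff_sub, coeff_C_mul, coeff_X_one, mul_one, coeff_C, if_neg one_ne_zero, sub_zero,
      coeff_zero] at h1
    exact c.den_ne_zero (by exact_mod_cast h1)
  · refine (natDegree_sub_le _ _).trans ?_
    rw [natDegree_C]
    exact max_le ((natDegree_C_mul_le _ _).trans (by rw [natDegree_X]; omega)) (Nat.zero_le _)
  · intro k
    simp only [coeff_sub, coeff_C_mul, coeff_X, coeff_C]
    have h1 : (c.den : ℤ) ≤ B := by omega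
    have h2 : |c.num| ≤ (B : ℤ) := by rw [← Int.natCast_natAbs]; omega
    have h3 := abs_le.mp h2
    split_ifs <;> simp_all [abs_le]
  · have hden : (c.den : ℂ) ≠ 0 := by exact_mod_cast c.den_ne_zero
    simp only [map_sub, map_mul, aeval_C, aeval_X, algebraMap_int_eq, Int.coe_castRingHom,
      Int.cast_natCast]
    rw [sub_eq_zero]
    have : ((c.den : ℚ) : ℂ) * (c : ℂ) = ((c.num : ℚ) : ℂ) := by
      rw [← Rat.cast_mul, Rat.den_mul_eq_num]
    simpa using this

/-! ### §1  Baker's Theorem 3.1 as a polynomial linear-independence measure for logarithms -/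

/-- `h ≠ 0 ⇒ 2 ≤ 1 + ∑ |hᵢ|`. -/
private theorem two_le_one_add_sum {n : ℕ} (h : Fin n → ℤ) (hh : h ≠ 0) :
    2 ≤ 1 + ∑ i, (h i).natAbs := by
  obtain ⟨i, hi⟩ : ∃ i, h i ≠ 0 := by
    by_contra hc
    push Not at hc
    exact hh (funext hc)
  have h1 : 1 ≤ (h i).natAbs := Int.natAbs_pos.mpr hi
  have h2 := single_le_sum (f := fun i => (h i).natAbs) (fun _ _ => Nat.zero_le _) (mem_univ i)
  omega

/-- Cast of `1 + Σ` to `ℝ`. -/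
private theorem cast_one_add_sum {n : ℕ} (h : Fin n → ℤ) :
    (((1 + ∑ i, (h i).natAbs : ℕ)) : ℝ) = 1 + ∑ i, (|h i| : ℝ) := by
  push_cast
  congr 1
  refine sum_congr rfl fun i _ => ?_
  rw [Nat.cast_natAbs, Int.cast_abs]

/-- From `B^{-C} < t` with `2 ≤ B` to `1 / B ^ ⌈C⌉₊ ≤ t`. -/
private theorem one_div_pow_ceil_le {B : ℕ} (hB : 2 ≤ B) {C t : ℝ} (h : (B : ℝ) ^ (-C) < t) :
    1 / (B : ℝ) ^ ⌈C⌉₊ ≤ t := by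
  have hBpos : (0 : ℝ) < B := by positivity
  have hB1 : (1 : ℝ) ≤ B := by exact_mod_cast (show 1 ≤ B by omega)
  calc 1 / (B : ℝ) ^ ⌈C⌉₊ = (B : ℝ) ^ (-(⌈C⌉₊ : ℝ)) := by
        rw [Real.rpow_neg hBpos.le, Real.rpow_natCast, one_div]
    _ ≤ (B : ℝ) ^ (-C) := Real.rpow_le_rpow_of_exponent_le hB1 (neg_le_neg (Nat.le_ceil C))
    _ ≤ t := h.le

/-- **`Λ ≠ 0` from `ℚ`-freeness**: a non-zero integer linear form in a `ℚ`-free tuple does not vanish. -/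
private theorem linForm_ne_zero_of_linearIndependent {n : ℕ} {l : Fin n → ℂ} (hli : LinearIndependent ℚ l)
    (h : Fin n → ℤ) (hh : h ≠ 0) : ∑ i, (h i : ℂ) * l i ≠ 0 := by
  intro h0
  apply hh
  have := (Fintype.linearIndependent_iff.mp hli) (fun i => (h i : ℚ)) (by simpa [Rat.smul_def] using h0)
  funext i
  exact_mod_cast this i

/-- **Polynomial linear-independence measure for logarithms of algebraic numbers** (Baker 1975,
Thm 3.1 with `β₀ = 0`, `βᵢ = hᵢ ∈ ℤ`, `B = 1 + ∑|hᵢ|`): a `ℚ`-free tuple `l` with all `e^{lᵢ}` algebraic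
has `|∑ hᵢ lᵢ| ≥ (1 + ∑|hᵢ|)^{-ω}` for one `ω` and every `h ∈ ℤⁿ ∖ 0`. -/
theorem polyMeasure_of_logs {n : ℕ} (l : Fin n → ℂ) (halg : ∀ i, IsAlgebraic ℚ (cexp (l i)))
    (hli : LinearIndependent ℚ l) :
    ∃ ω : ℕ, ∀ h : Fin n → ℤ, h ≠ 0 → 1 / (1 + ∑ i, (|h i| : ℝ)) ^ ω ≤ ‖∑ i, (h i : ℂ) * l i‖ := by
  classical
  obtain ⟨d, A, hd2, hwit⟩ := exists_common_witness (fun i => cexp (l i)) halg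
  obtain ⟨C, _hC, hmain⟩ := baker1975_thm_3_1_holds n d A (fun i => cexp (l i)) l
    (fun i => Complex.exp_ne_zero _) (fun _ => rfl) hwit
  refine ⟨⌈C⌉₊, fun h hh => ?_⟩
  set Bn : ℕ := 1 + ∑ i, (h i).natAbs with hBn
  have hB2 : 2 ≤ Bn := two_le_one_add_sum h hh
  let βz : Fin (n + 1) → ℤ := Fin.cons 0 h
  have hβB : ∀ j, (βz j).natAbs ≤ Bn := by
    intro j
    refine Fin.cases ?_ (fun i => ?_) j
    · simp [βz]
    · simp only [βz, Fin.cons_succ]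
      have := single_le_sum (f := fun i => (h i).natAbs) (fun _ _ => Nat.zero_le _) (mem_univ i)
      omega
  have hres := hmain Bn hB2 (fun j => (βz j : ℂ)) (fun j => wit_int (βz j) hB2 hd2 (hβB j))
  have hΛ : ((βz 0 : ℤ) : ℂ) + ∑ i : Fin n, ((βz i.succ : ℤ) : ℂ) * l i = ∑ i, (h i : ℂ) * l i := by
    simp [βz]
  rw [hΛ] at hres
  rcases hres with h0 | hlt
  · exact absurd h0 (linForm_ne_zero_of_linearIndependent hli h hh)
  · rw [← cast_one_add_sum]
    exact one_div_pow_ceil_le hB2 hlt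

/-- The CLAIM's name for `polyMeasure_of_logs` (L2309 §2 (a)). -/
theorem polyDioph_of_logs {n : ℕ} (l : Fin n → ℂ) (halg : ∀ i, IsAlgebraic ℚ (cexp (l i)))
    (hli : LinearIndependent ℚ l) :
    ∃ ω : ℕ, ∀ h : Fin n → ℤ, h ≠ 0 → 1 / (1 + ∑ i, (|h i| : ℝ)) ^ ω ≤ ‖∑ i, (h i : ℂ) * l i‖ :=
  polyMeasure_of_logs l halg hli

end Summit.Schanuel.Schanuel.Theorems.RootDecomp1KB3LogBarrier

end
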